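import Summits.AtomisticToContinuum.HydrodynamicLimit.Theorems.InformationPercolationEngineChaosClosesEulerStressIsotropyA
import HarnessLib

/-!
# Weak stress isotropy in band (crux `ChaosClosesEuler`, stmt-AtomisticToContinuum-15141, line `Sketch`,
# stub `stub_stressIsotropyOfLocalEquilibrium`) — helper B: the bulk cut-off and the non-bulk bound

WHAT. Pathwise, pointwise bookkeeping for ONE configuration `w` and ONE centre `x` (continued):

* the continuous bulk cut-off `bulkCut ρ₁ θ₁ Θ U (ρ, u, θ) ∈ [0, 1]` (product of four clamps: `= 0` off
  `{ρ > ρ₁, θ₁ < θ < Θ, ‖u‖ < U}`, `= 1` on `{ρ ≥ 2ρ₁, 2θ₁ ≤ θ ≤ Θ/2, ‖u‖ ≤ U/2}`);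
* THE NON-BULK BOUND `one_sub_bulkCut_mul_le`:
  `(1 − χ)ρ_rθ_r ≤ 2θ₁ρ_r + ρ₁Θ + (4M²/(9Θ) + 8M²/(3U²)) e_r + (2/3) MpsiC (sqTail M)`
  (cold / dilute-and-temperate / hot `ρ_r ≤ 4e_r/(3Θ)` / fast `ρ_r ≤ 8e_r/U²`, energy split at speed `M`).

No named fact is invoked.
-/

noncomputable section

namespace Summit.AtomisticToContinuum.HydrodynamicLimit.Theorems.ChaosClosesEulerStressIsotropy

open scoped BigOperators Topology Classical MeasureTheory ENNReal InnerProductSpace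
open Filter Set MeasureTheory Function
open Literature.MathematicalPhysics.KineticTheory
open Literature.Analysis.FluidPDE
open Literature.Analysis.FunctionSpaces
open Summit.AtomisticToContinuum.HydrodynamicLimit.Theorems.LocalSecondLawNegative
open Summit.AtomisticToContinuum.HydrodynamicLimit.Theorems.LocalSecondLawLedger
open Summit.AtomisticToContinuum.HydrodynamicLimit.Theorems.LocalSecondLawLedger.L
  (Mmom rhoC_eq_sum momC_apply_eq_sum momC_eq_sum uC_apply norm_sq_eq_sum)
open Summit.AtomisticToContinuum.HydrodynamicLimit.Theorems.ChaosClosesEulerReduction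

variable {N : ℕ}

/-! ## §1 The bulk cut-off in the state -/

/-- The clamp to `[0, 1]`. [folklore] -/
def clamp01 (x : ℝ) : ℝ := max 0 (min 1 x)

/-- `0 ≤ clamp01`. [folklore] -/
theorem clamp01_nonneg (x : ℝ) : 0 ≤ clamp01 x := le_max_left _ _

/-- `clamp01 ≤ 1`. [folklore] -/
theorem clamp01_le_one (x : ℝ) : clamp01 x ≤ 1 := max_le zero_le_one (min_le_left _ _)

/-- `clamp01 = 0` on `(-∞, 0]`. [folklore] -/
theorem clamp01_of_nonpos {x : ℝ} (hx : x ≤ 0) : clamp01 x = 0 := by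
  unfold clamp01; exact max_eq_left ((min_le_right _ _).trans hx)

/-- `clamp01 = 1` on `[1, ∞)`. [folklore] -/
theorem clamp01_of_one_le {x : ℝ} (hx : 1 ≤ x) : clamp01 x = 1 := by
  unfold clamp01; rw [min_eq_left hx, max_eq_right zero_le_one]

/-- The clamp is continuous. [folklore] -/
theorem continuous_clamp01 : Continuous clamp01 := by
  unfold clamp01; exact continuous_const.max (continuous_const.min continuous_id)

/-- **The bulk cut-off** `χ(ρ, u, θ)`: product of four clamps — vanishes off `{ρ > ρ₁, θ₁ < θ < Θ, ‖u‖ < U}`, equals `1`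
on `{ρ ≥ 2ρ₁, 2θ₁ ≤ θ ≤ Θ/2, ‖u‖ ≤ U/2}`. [folklore] -/
def bulkCut (ρ₁ θ₁ Θ U : ℝ) (p : ℝ × V3 × ℝ) : ℝ :=
  clamp01 ((p.1 - ρ₁) / ρ₁) * clamp01 ((p.2.2 - θ₁) / θ₁) * clamp01 ((Θ - p.2.2) / (Θ / 2)) *
    clamp01 ((U - ‖p.2.1‖) / (U / 2))

/-- The bulk cut-off is continuous. [folklore] -/
theorem continuous_bulkCut (ρ₁ θ₁ Θ U : ℝ) : Continuous (bulkCut ρ₁ θ₁ Θ U) := by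
  unfold bulkCut
  refine ((Continuous.mul (Continuous.mul ?_ ?_) ?_).mul ?_)
  · exact continuous_clamp01.comp ((continuous_fst.sub continuous_const).div_const _)
  · exact continuous_clamp01.comp ((continuous_snd.snd.sub continuous_const).div_const _)
  · exact continuous_clamp01.comp ((continuous_const.sub continuous_snd.snd).div_const _)
  · exact continuous_clamp01.comp ((continuous_const.sub continuous_snd.fst.norm).div_const _)

/-- `0 ≤ χ`. [folklore] -/
theorem bulkCut_nonneg (ρ₁ θ₁ Θ U : ℝ) (p : ℝ × V3 × ℝ) : 0 ≤ bulkCut ρ₁ θ₁ Θ U p := by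
  unfold bulkCut
  exact mul_nonneg (mul_nonneg (mul_nonneg (clamp01_nonneg _) (clamp01_nonneg _)) (clamp01_nonneg _))
    (clamp01_nonneg _)

/-- `χ ≤ 1`. [folklore] -/
theorem bulkCut_le_one (ρ₁ θ₁ Θ U : ℝ) (p : ℝ × V3 × ℝ) : bulkCut ρ₁ θ₁ Θ U p ≤ 1 := by
  unfold bulkCut
  refine mul_le_one₀ (mul_le_one₀ (mul_le_one₀ (clamp01_le_one _) (clamp01_nonneg _) (clamp01_le_one _))
    (clamp01_nonneg _) (clamp01_le_one _)) (clamp01_nonneg _) (clamp01_le_one _)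

/-- **Support of the bulk cut-off**: `χ = 0` off `{ρ > ρ₁, θ₁ < θ < Θ, ‖u‖ < U}`. [folklore] -/
theorem bulkCut_eq_zero {ρ₁ θ₁ Θ U : ℝ} (hρ₁ : 0 < ρ₁) (hθ₁ : 0 < θ₁) (hΘ : 0 < Θ) (hU : 0 < U)
    {p : ℝ × V3 × ℝ} (h : p.1 ≤ ρ₁ ∨ p.2.2 ≤ θ₁ ∨ Θ ≤ p.2.2 ∨ U ≤ ‖p.2.1‖) : bulkCut ρ₁ θ₁ Θ U p = 0 := by
  unfold bulkCut
  rcases h with h | h | h | h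
  · rw [clamp01_of_nonpos (x := (p.1 - ρ₁) / ρ₁) (div_nonpos_of_nonpos_of_nonneg (by linarith) hρ₁.le)]
    simp
  · rw [clamp01_of_nonpos (x := (p.2.2 - θ₁) / θ₁) (div_nonpos_of_nonpos_of_nonneg (by linarith) hθ₁.le)]
    simp
  · rw [clamp01_of_nonpos (x := (Θ - p.2.2) / (Θ / 2))
      (div_nonpos_of_nonpos_of_nonneg (by linarith) (by positivity))]
    simp
  · rw [clamp01_of_nonpos (x := (U - ‖p.2.1‖) / (U / 2))
      (div_nonpos_of_nonpos_of_nonneg (sub_nonpos.2 h) (by positivity))]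
    simp

/-- **The bulk box**: `χ = 1` on `{ρ ≥ 2ρ₁, 2θ₁ ≤ θ ≤ Θ/2, ‖u‖ ≤ U/2}`. [folklore] -/
theorem bulkCut_eq_one {ρ₁ θ₁ Θ U : ℝ} (hρ₁ : 0 < ρ₁) (hθ₁ : 0 < θ₁) (hΘ : 0 < Θ) (hU : 0 < U)
    {p : ℝ × V3 × ℝ} (h1 : 2 * ρ₁ ≤ p.1) (h2 : 2 * θ₁ ≤ p.2.2) (h3 : p.2.2 ≤ Θ / 2) (h4 : ‖p.2.1‖ ≤ U / 2) :
    bulkCut ρ₁ θ₁ Θ U p = 1 := by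
  unfold bulkCut
  rw [clamp01_of_one_le, clamp01_of_one_le, clamp01_of_one_le, clamp01_of_one_le]
  · norm_num
  · rw [le_div_iff₀ (by positivity)]; linarith
  · rw [le_div_iff₀ (by positivity)]; linarith
  · rw [le_div_iff₀ hθ₁]; linarith
  · rw [le_div_iff₀ hρ₁]; linarith

/-! ## §2 The non-bulk bound -/

/-- The hot spots: on `{θ_r > Θ/2}`, `ρ_rθ_r ≤ (4M²/(9Θ)) e_r + ⅓ MpsiC (sqTail M)`. [folklore] -/
theorem rhoC_mul_thetaC_le_of_hot {r : ℝ} (hr : 0 < r) (w : Phase N) (x : T3) {Θ : ℝ} (M : ℝ) (hΘ : 0 < Θ)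
    (hhot : Θ / 2 < thetaC r w x) :
    rhoC r w x * thetaC r w x ≤ 4 * M ^ 2 / (9 * Θ) * kinC r w x + MpsiC r w x (sqTail M) / 3 := by
  have hρ0 := rhoC_nonneg hr w x
  have hρθ := psvK_rhoC_mul_thetaC_le hr w x
  have hkin := kinC_le_add_tail hr w x M
  have h1 : rhoC r w x * (Θ / 2) ≤ 2 / 3 * kinC r w x :=
    (mul_le_mul_of_nonneg_left hhot.le hρ0).trans hρθ
  have h2 : rhoC r w x ≤ 4 / (3 * Θ) * kinC r w x := by
    rw [div_mul_eq_mul_div, le_div_iff₀ (by positivity)]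
    linarith
  have h3 : M ^ 2 / 2 * rhoC r w x ≤ M ^ 2 / 2 * (4 / (3 * Θ) * kinC r w x) :=
    mul_le_mul_of_nonneg_left h2 (by positivity)
  have h4 : M ^ 2 / 2 * (4 / (3 * Θ) * kinC r w x) = 3 / 2 * (4 * M ^ 2 / (9 * Θ) * kinC r w x) := by
    ring
  linarith

/-- The fast spots: on `{‖u_r‖ > U/2}`, `ρ_rθ_r ≤ (8M²/(3U²)) e_r + ⅓ MpsiC (sqTail M)`. [folklore] -/
theorem rhoC_mul_thetaC_le_of_fast {r : ℝ} (hr : 0 < r) (w : Phase N) (x : T3) {U : ℝ} (M : ℝ) (hU : 0 < U)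
    (hfast : U / 2 < ‖uC r w x‖) :
    rhoC r w x * thetaC r w x ≤ 8 * M ^ 2 / (3 * U ^ 2) * kinC r w x + MpsiC r w x (sqTail M) / 3 := by
  have hρ0 := rhoC_nonneg hr w x
  have hρθ := psvK_rhoC_mul_thetaC_le hr w x
  have hkin := kinC_le_add_tail hr w x M
  have hu := rhoC_mul_norm_uC_sq_le hr w x
  have h0 : (U / 2) ^ 2 ≤ ‖uC r w x‖ ^ 2 := pow_le_pow_left₀ (by positivity) hfast.le 2
  have h1 : rhoC r w x * (U / 2) ^ 2 ≤ 2 * kinC r w x := (mul_le_mul_of_nonneg_left h0 hρ0).trans hu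
  have h2 : rhoC r w x ≤ 8 / U ^ 2 * kinC r w x := by
    rw [div_mul_eq_mul_div, le_div_iff₀ (by positivity)]
    nlinarith
  have h3 : M ^ 2 / 2 * rhoC r w x ≤ M ^ 2 / 2 * (8 / U ^ 2 * kinC r w x) :=
    mul_le_mul_of_nonneg_left h2 (by positivity)
  have h4 : M ^ 2 / 2 * (8 / U ^ 2 * kinC r w x) = 3 / 2 * (8 * M ^ 2 / (3 * U ^ 2) * kinC r w x) := by
    ring
  linarith

/-- **THE NON-BULK BOUND.** With `χ = bulkCut ρ₁ θ₁ Θ U (ρ_r, u_r, θ_r)`: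
`(1 − χ) ρ_rθ_r ≤ 2θ₁ρ_r + ρ₁Θ + (4M²/(9Θ) + 8M²/(3U²)) e_r + (2/3) MpsiC (sqTail M)` — off the bulk box one of
cold / dilute-and-temperate / hot / fast holds. [folklore] -/
theorem one_sub_bulkCut_mul_le {r : ℝ} (hr : 0 < r) (w : Phase N) (x : T3) {ρ₁ θ₁ Θ U : ℝ} (M : ℝ)
    (hρ₁ : 0 < ρ₁) (hθ₁ : 0 < θ₁) (hΘ : 0 < Θ) (hU : 0 < U) :
    (1 - bulkCut ρ₁ θ₁ Θ U (rhoC r w x, uC r w x, thetaC r w x)) * (rhoC r w x * thetaC r w x) ≤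
      2 * θ₁ * rhoC r w x + ρ₁ * Θ + (4 * M ^ 2 / (9 * Θ) + 8 * M ^ 2 / (3 * U ^ 2)) * kinC r w x +
        2 / 3 * MpsiC r w x (sqTail M) := by
  have hρ0 := rhoC_nonneg hr w x
  have hρθ0 := psvK_rhoC_mul_thetaC_nonneg hr w x
  have he0 := kinC_nonneg hr w x
  have htl : 0 ≤ MpsiC r w x (sqTail M) := MpsiC_nonneg hr w x (sqTail_nonneg M)
  set p : ℝ × V3 × ℝ := (rhoC r w x, uC r w x, thetaC r w x) with hp
  have hχ0 := bulkCut_nonneg ρ₁ θ₁ Θ U p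
  have hχ1 := bulkCut_le_one ρ₁ θ₁ Θ U p
  have hA : 0 ≤ 2 * θ₁ * rhoC r w x := by positivity
  have hB : 0 ≤ ρ₁ * Θ := by positivity
  have hC : 0 ≤ 4 * M ^ 2 / (9 * Θ) * kinC r w x := by positivity
  have hD : 0 ≤ 8 * M ^ 2 / (3 * U ^ 2) * kinC r w x := by positivity
  have hprod : 0 ≤ bulkCut ρ₁ θ₁ Θ U p * (rhoC r w x * thetaC r w x) := mul_nonneg hχ0 hρθ0
  have hle : (1 - bulkCut ρ₁ θ₁ Θ U p) * (rhoC r w x * thetaC r w x) ≤ rhoC r w x * thetaC r w x := by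
    linarith
  by_cases hbox : 2 * ρ₁ ≤ rhoC r w x ∧ 2 * θ₁ ≤ thetaC r w x ∧ thetaC r w x ≤ Θ / 2 ∧ ‖uC r w x‖ ≤ U / 2
  · have h1 : bulkCut ρ₁ θ₁ Θ U p = 1 :=
      bulkCut_eq_one (p := p) hρ₁ hθ₁ hΘ hU hbox.1 hbox.2.1 hbox.2.2.1 hbox.2.2.2
    rw [h1, sub_self, zero_mul]
    linarith
  · simp only [not_and_or, not_le] at hbox
    rcases hbox with h | h | h | h
    · -- dilute
      by_cases hhot : Θ / 2 < thetaC r w x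
      · have h5 := rhoC_mul_thetaC_le_of_hot hr w x M hΘ hhot
        linarith
      · rw [not_lt] at hhot
        have h1 : rhoC r w x * thetaC r w x ≤ rhoC r w x * (Θ / 2) := mul_le_mul_of_nonneg_left hhot hρ0
        have h2 : rhoC r w x * (Θ / 2) ≤ 2 * ρ₁ * (Θ / 2) := mul_le_mul_of_nonneg_right h.le (by positivity)
        linarith
    · -- cold
      have h1 : rhoC r w x * thetaC r w x ≤ rhoC r w x * (2 * θ₁) := mul_le_mul_of_nonneg_left h.le hρ0
      linarith
    · -- hot
      have h5 := rhoC_mul_thetaC_le_of_hot hr w x M hΘ h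
      linarith
    · -- fast
      have h5 := rhoC_mul_thetaC_le_of_fast hr w x M hU h
      linarith

/-! ## §3 Registered sub-goal -/

/-- **Registered sub-goal `stub_stressIsotropyHot` (helper B of `stub_stressIsotropyOfLocalEquilibrium`): the hot
spots carry little pressure** — on `{θ_r > Θ/2}`, `ρ_rθ_r ≤ (4M²/(9Θ)) e_r + ⅓ MpsiC (sqTail M)` (mass of hot spots
`≤ 4e_r/(3Θ)`, energy split at speed `M`). [folklore] -/
theorem stub_stressIsotropyHot : ∀ {N : ℕ} {r : ℝ}, 0 < r → ∀ (w : Config (N + 1) (Fin 3) T3) (x : T3) {Θ : ℝ} (M : ℝ), 0 < Θ → Θ / 2 < thetaC r w x → rhoC r w x * thetaC r w x ≤ 4 * M ^ 2 / (9 * Θ) * kinC r w x + MpsiC r w x (sqTail M) / 3 :=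
  fun hr w x _ M hΘ hhot => rhoC_mul_thetaC_le_of_hot hr w x M hΘ hhot

end Summit.AtomisticToContinuum.HydrodynamicLimit.Theorems.ChaosClosesEulerStressIsotropy

end
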